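/-
Copyright: the b2b-balaban T⁴-continuum CRUX team, row NE7b OWNER lineage `t4-ne7b-p1` (gen 106). Project licence.
-/
import Summits.QuantumFields.BalabanUV.T4Continuum.Spine.NE7b.ConvexTiltMoment

/-!
# HOW FAR A PERTURBATION MOVES THE TILTED MEAN, DERIVATIVE-FREE: `𝔼_{μ_P} f − 𝔼_μ f = Cov_μ(f, e^{−P}) ∕ 𝔼_μ e^{−P}`, AM–GM on the
# covariance, Jensen below on `𝔼_μ e^{−P}`, and Brascamp–Lieb (IN THE TREE) twice — the tilted-mean letter `m` of the convexity road
# controlled by the L² size of `∇P` under the UNPERTURBED tilt (row NE7b, node U5c; residual (R1″)-class letter of T-60a′; idea-1's T-60e)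

Cell `pub-balaban`, sub-cell `t4`, spine estimate NE7b (`T4WeightBudget.RelWeightBound`; the cell's OWN estimate — NOT PRINTED in
[Bałaban 1983–89], NOT PROVED).  Crux-route work under `Spine/NE7b/` by the row's OWNER; NOTHING of Bałaban's is named or asserted;
no `T4Continuum/Support` leaf typed; no `def`; zero `sorry`.

WHY.  `…NE7b.ConvexTiltMoment.exp_moment_le_of_uniformlyConvex` (T-60a′) bounds the sacrificed exponential moment by
`exp(tr(Q)∕λ + Σ_k q_k m_k²)` with `m_k = 𝔼_{ν_V}⟪u_k, x⟫` the means under the TILTED measure of the full exponent `V = W₀ + P`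
(`W₀` the shifted Gaussian part, whose means are the induced means of record, `P` the anharmonic part).  The refuter (PRICING-NE7b v71
F389 (iii)) and idea-1 (T-60e) located the remaining question: how far does `P` move the mean away from the Gaussian one?  By VALUE
(`sup|P|`) the answer is useless for the anharmonic family; in the convexity currency it is cheap.  THIS FILE proves the derivative-free
form: for a probability measure `μ` and the re-weighted `μ_P = e^{−P}μ ∕ 𝔼_μe^{−P}`, the exact identity
`𝔼_{μ_P} f − 𝔼_μ f = Cov_μ(f, e^{−P}) ∕ 𝔼_μ e^{−P}`, the AM–GM bound `|Cov_μ(f, g)| ≤ (a∕2)·Var_μ f + Var_μ g ∕ (2a)` (any `a > 0`,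
displayed — the consumer optimises), Jensen `𝔼_μ e^{−P} ≥ e^{−𝔼_μ P}`; and for `μ = ν_{W₀}` with `W₀` `λ`-uniformly convex on
`EuclideanSpace ℝ (Fin n)` the tree's Brascamp–Lieb inequality (`Literature.Probability.Moments.variance_tilted_le`) TWICE — at the linear
test function `⟪u, ·⟫` (`Var ≤ λ⁻¹‖u‖²`) and at `e^{−P}` (`Var ≤ λ⁻¹·𝔼‖∇e^{−P}‖² = λ⁻¹·𝔼(e^{−2P}‖∇P‖²)`).  NET:
**`|𝔼_{W₀+P}⟪u,x⟫ − 𝔼_{W₀}⟪u,x⟫| ≤ e^{𝔼₀P} · λ⁻¹ · [(a∕2)‖u‖² + 𝔼₀(‖∇e^{−P}‖²)∕(2a)]`** — the shift of the tilted mean is governed by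
the L² size of `∇P` under the UNPERTURBED tilt (typical fields), value-free but for the integrated `e^{𝔼₀P}`.

WHAT IS PROVED ([folklore]; Bochner linearity, `abs_integral_le_integral_abs`, `tilted_tilted` ∕ `integral_tilted`, the tree's BL):
* §1 (any probability space) `abs_mul_le_amgm`, **`abs_cov_le_amgm`**, **`integral_exp_neg_ge_exp_neg_integral`** (Jensen below, from the
  tangent line of `…ConvexTiltMoment.exp_neg_tangent`), **`tiltedMean_sub_eq_cov_div`** (the exact identity for `μ.tilted (−P)`).
* §2 (uniformly log-concave tilt on `EuclideanSpace ℝ (Fin n)`) `variance_inner_le`, `variance_exp_neg_le`,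
  **`abs_tiltedMean_shift_le`** (the display above, with `𝔼₀‖∇e^{−P}‖²` as the tree's `‖fderiv ℝ (e^{−P}) x‖²`), and
  `norm_fderiv_exp_neg` (`‖∇e^{−P}(x)‖ = e^{−P x}·‖∇P(x)‖`).

SCOPE (idea-1 g62's located remarks R-62-1 ∕ R-62-2, taken): in the fibre architecture of `…LocalPerturbationSandwich` the
perturbation `P` here is the NEAR part `V₁` only (the far part rides the fibre weight), so `∫P dν` and `∫‖∇e^{−P}‖² dν` are
REGION-extensive like `tr(Q)`, not volume-extensive; the bound keeps `∫e^{−P}dν` itself in the denominator (Jensen's `e^{−∫P dν}` is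
offered separately, not forced); the INTENSIVE letter — decay of `Cov(⟪u,·⟫, P_p)` in the distance from `supp u` to the term `P_p` —
and the interpolation form `sup_t 𝔼_{W₀+tP}‖∇P‖²` (no `e^{∫P}`) are NOT here.

NOT HERE (honest): the size of `∇P` and of `𝔼₀P` for Bałaban's anharmonic remainders ((A1c) readings); anything of Bałaban's.
NE7b NOT PRINTED ∕ NOT PROVED; spine PROVED 0∕9; rung (B)+1 on a FINITE torus — NOT infinite volume, NOT the mass gap, NOT Clay.
HONEST DEPENDENCY: continuum YM on T⁴ ⇐ BetaPertH ∧ nine spine estimates (0/9 proved); BetaPertH ⇐ (D1) ∧ (D4) ∧ CAP+tail.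
-/

set_option autoImplicit false

noncomputable section

open MeasureTheory Real Finset
open scoped RealInnerProductSpace
open Literature.Probability.Moments
open Summit.QuantumFields.BalabanUV.T4Continuum.NE7b.ConvexTiltMoment

namespace Summit.QuantumFields.BalabanUV.T4Continuum.NE7b.TiltedMeanShift

/-! ## §1 Any probability space: the covariance identity, AM–GM, Jensen below -/

section Prob

variable {X : Type*} [MeasurableSpace X] (μ : Measure X) [IsProbabilityMeasure μ]

omit [MeasurableSpace X] in
/-- AM–GM: `|p·q| ≤ (a∕2)p² + q²∕(2a)` for `a > 0`. [folklore] -/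
theorem abs_mul_le_amgm {a : ℝ} (ha : 0 < a) (p q : ℝ) : |p * q| ≤ a / 2 * p ^ 2 + q ^ 2 / (2 * a) := by
  rw [abs_mul]
  have h := sq_nonneg (a * |p| - |q|)
  have hp := sq_abs p
  have hq := sq_abs q
  have key : 2 * a * (|p| * |q|) ≤ a ^ 2 * p ^ 2 + q ^ 2 := by nlinarith [abs_nonneg p, abs_nonneg q]
  have e : a / 2 * p ^ 2 + q ^ 2 / (2 * a) = (a ^ 2 * p ^ 2 + q ^ 2) / (2 * a) := by
    field_simp
  rw [e, le_div_iff₀ (by positivity)]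
  nlinarith [key]

/-- **AM–GM ON THE COVARIANCE** (probability measure; `f, g, f², g², f·g` integrable; any `a > 0`):
`|∫fg − (∫f)(∫g)| ≤ (a∕2)·(∫f² − (∫f)²) + (∫g² − (∫g)²)∕(2a)`. [folklore] -/
theorem abs_cov_le_amgm {f g : X → ℝ} {a : ℝ} (ha : 0 < a) (hf : Integrable f μ) (hg : Integrable g μ)
    (hf2 : Integrable (fun x => f x ^ 2) μ) (hg2 : Integrable (fun x => g x ^ 2) μ) (hfg : Integrable (fun x => f x * g x) μ) :
    |∫ x, f x * g x ∂μ - (∫ x, f x ∂μ) * ∫ x, g x ∂μ| ≤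
      a / 2 * (∫ x, f x ^ 2 ∂μ - (∫ x, f x ∂μ) ^ 2) + (∫ x, g x ^ 2 ∂μ - (∫ x, g x ∂μ) ^ 2) / (2 * a) := by
  set mf := ∫ x, f x ∂μ with hmf
  set mg := ∫ x, g x ∂μ with hmg
  -- centred integrands
  have hcf : Integrable (fun x => f x - mf) μ := hf.sub (integrable_const _)
  have hcg : Integrable (fun x => g x - mg) μ := hg.sub (integrable_const _)
  have hprod : Integrable (fun x => (f x - mf) * (g x - mg)) μ := by
    have : (fun x => (f x - mf) * (g x - mg)) = fun x => f x * g x - mg * f x - mf * g x + mf * mg := by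
      funext x; ring
    rw [this]
    exact ((hfg.sub (hf.const_mul _)).sub (hg.const_mul _)).add (integrable_const _)
  have hsqf : Integrable (fun x => (f x - mf) ^ 2) μ := by
    have : (fun x => (f x - mf) ^ 2) = fun x => f x ^ 2 - 2 * mf * f x + mf ^ 2 := by funext x; ring
    rw [this]; exact (hf2.sub (hf.const_mul _)).add (integrable_const _)
  have hsqg : Integrable (fun x => (g x - mg) ^ 2) μ := by
    have : (fun x => (g x - mg) ^ 2) = fun x => g x ^ 2 - 2 * mg * g x + mg ^ 2 := by funext x; ring
    rw [this]; exact (hg2.sub (hg.const_mul _)).add (integrable_const _)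
  -- the three integral identities
  have ecov : ∫ x, (f x - mf) * (g x - mg) ∂μ = ∫ x, f x * g x ∂μ - mf * mg := by
    have e : (fun x => (f x - mf) * (g x - mg)) = fun x => f x * g x - mg * f x - mf * g x + mf * mg := by
      funext x; ring
    have i1 : Integrable (fun x => mg * f x) μ := hf.const_mul mg
    have i2 : Integrable (fun x => mf * g x) μ := hg.const_mul mf
    have i3 : Integrable (fun x => f x * g x - mg * f x) μ := hfg.sub i1
    have i4 : Integrable (fun x => f x * g x - mg * f x - mf * g x) μ := i3.sub i2
    have i5 : Integrable (fun _ : X => mf * mg) μ := integrable_const _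
    rw [e, integral_add i4 i5, integral_sub i3 i2, integral_sub hfg i1, integral_const_mul, integral_const_mul,
      integral_const, smul_eq_mul, probReal_univ, one_mul]
    ring
  have evf : ∫ x, (f x - mf) ^ 2 ∂μ = ∫ x, f x ^ 2 ∂μ - mf ^ 2 := by
    have e : (fun x => (f x - mf) ^ 2) = fun x => f x ^ 2 - 2 * mf * f x + mf ^ 2 := by funext x; ring
    have i1 : Integrable (fun x => 2 * mf * f x) μ := hf.const_mul _
    have i2 : Integrable (fun x => f x ^ 2 - 2 * mf * f x) μ := hf2.sub i1
    have i3 : Integrable (fun _ : X => mf ^ 2) μ := integrable_const _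
    rw [e, integral_add i2 i3, integral_sub hf2 i1, integral_const_mul, integral_const, smul_eq_mul, probReal_univ,
      one_mul]
    ring
  have evg : ∫ x, (g x - mg) ^ 2 ∂μ = ∫ x, g x ^ 2 ∂μ - mg ^ 2 := by
    have e : (fun x => (g x - mg) ^ 2) = fun x => g x ^ 2 - 2 * mg * g x + mg ^ 2 := by funext x; ring
    have i1 : Integrable (fun x => 2 * mg * g x) μ := hg.const_mul _
    have i2 : Integrable (fun x => g x ^ 2 - 2 * mg * g x) μ := hg2.sub i1
    have i3 : Integrable (fun _ : X => mg ^ 2) μ := integrable_const _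
    rw [e, integral_add i2 i3, integral_sub hg2 i1, integral_const_mul, integral_const, smul_eq_mul, probReal_univ,
      one_mul]
    ring
  rw [← ecov, ← evf, ← evg]
  calc |∫ x, (f x - mf) * (g x - mg) ∂μ| ≤ ∫ x, |(f x - mf) * (g x - mg)| ∂μ := abs_integral_le_integral_abs
    _ ≤ ∫ x, a / 2 * (f x - mf) ^ 2 + (g x - mg) ^ 2 / (2 * a) ∂μ :=
        by
          have j1 : Integrable (fun x => a / 2 * (f x - mf) ^ 2) μ := hsqf.const_mul _
          have j2 : Integrable (fun x => (g x - mg) ^ 2 / (2 * a)) μ := hsqg.div_const _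
          have j12 : Integrable (fun x => a / 2 * (f x - mf) ^ 2 + (g x - mg) ^ 2 / (2 * a)) μ := j1.add j2
          have jabs : Integrable (fun x => |(f x - mf) * (g x - mg)|) μ := hprod.abs
          exact integral_mono jabs j12 fun x => abs_mul_le_amgm ha _ _
    _ = a / 2 * ∫ x, (f x - mf) ^ 2 ∂μ + (∫ x, (g x - mg) ^ 2 ∂μ) / (2 * a) := by
        have j1 : Integrable (fun x => a / 2 * (f x - mf) ^ 2) μ := hsqf.const_mul _
        have j2 : Integrable (fun x => (g x - mg) ^ 2 / (2 * a)) μ := hsqg.div_const _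
        rw [integral_add j1 j2, integral_const_mul, integral_div]

/-- **JENSEN BELOW** (probability measure): `∫e^{−P} ≥ e^{−∫P}` for `P`, `e^{−P}` integrable — from the tangent line
`e^{−c}(1 + c − t) ≤ e^{−t}` at `c = ∫P`. [folklore] -/
theorem integral_exp_neg_ge_exp_neg_integral {P : X → ℝ} (hP : Integrable P μ) (heP : Integrable (fun x => exp (-P x)) μ) :
    exp (-∫ x, P x ∂μ) ≤ ∫ x, exp (-P x) ∂μ := by
  set c := ∫ x, P x ∂μ with hc
  have i1 : Integrable (fun x => 1 + c - P x) μ := (integrable_const _).sub hP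
  have i2 : Integrable (fun x => exp (-c) * (1 + c - P x)) μ := i1.const_mul _
  have hle : ∫ x, exp (-c) * (1 + c - P x) ∂μ ≤ ∫ x, exp (-P x) ∂μ :=
    integral_mono i2 heP fun x => exp_neg_tangent c (P x)
  have i3 : Integrable (fun _ : X => 1 + c) μ := integrable_const _
  rw [integral_const_mul, integral_sub i3 hP, integral_const, smul_eq_mul, probReal_univ, one_mul] at hle
  have e : exp (-c) * (1 + c - c) = exp (-c) := by ring
  rwa [e] at hle

/-- **THE EXACT IDENTITY FOR THE RE-WEIGHTED MEAN**: with `μ` a probability measure, `e^{−P}` integrable and `μ_P = μ.tilted (−P)`,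
`∫f dμ_P − ∫f dμ = (∫f·e^{−P} dμ − (∫f dμ)(∫e^{−P} dμ)) ∕ ∫e^{−P} dμ` = `Cov_μ(f, e^{−P}) ∕ 𝔼_μ e^{−P}`. [folklore] -/
theorem tiltedMean_sub_eq_cov_div {P f : X → ℝ} (heP : Integrable (fun x => exp (-P x)) μ) :
    ∫ x, f x ∂(μ.tilted fun x => -P x) - ∫ x, f x ∂μ =
      (∫ x, f x * exp (-P x) ∂μ - (∫ x, f x ∂μ) * ∫ x, exp (-P x) ∂μ) / ∫ x, exp (-P x) ∂μ := by
  have hZ : 0 < ∫ x, exp (-P x) ∂μ := integral_exp_pos heP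
  rw [integral_tilted]
  have e : (fun x => (exp (-P x) / ∫ y, exp (-P y) ∂μ) • f x) = fun x => (∫ y, exp (-P y) ∂μ)⁻¹ * (f x * exp (-P x)) := by
    funext x; rw [smul_eq_mul]; ring
  rw [e, integral_const_mul]
  field_simp

end Prob

/-! ## §2 A uniformly log-concave reference measure: Brascamp–Lieb twice -/

section Euclidean

variable {n : ℕ}

/-- `‖∇e^{−P}(x)‖ = e^{−P x}·‖∇P(x)‖` for `P` differentiable at `x`. [folklore] -/
theorem norm_fderiv_exp_neg {P : EuclideanSpace ℝ (Fin n) → ℝ} {x : EuclideanSpace ℝ (Fin n)} (hP : DifferentiableAt ℝ P x) :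
    ‖fderiv ℝ (fun y => exp (-P y)) x‖ = exp (-P x) * ‖fderiv ℝ P x‖ := by
  have h : HasFDerivAt (fun y => exp (-P y)) (exp (-P x) • -fderiv ℝ P x) x := hP.hasFDerivAt.neg.exp
  rw [h.fderiv, norm_smul, Real.norm_of_nonneg (exp_pos _).le, norm_neg]

/-- **BL AT A LINEAR TEST FUNCTION** (variance form): `∫⟪u,x⟫² dν − (∫⟪u,x⟫dν)² ≤ λ⁻¹‖u‖²` under the `λ`-uniformly log-concave
tilt `ν = volume.tilted (−W)`. [folklore] -/
theorem variance_inner_le {W : EuclideanSpace ℝ (Fin n) → ℝ} {lam : ℝ} (hlam : 0 < lam) (hWc : Continuous W)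
    (hW : ∀ x y : EuclideanSpace ℝ (Fin n), W x + ⟪gradient W x, y - x⟫ + lam / 2 * ‖y - x‖ ^ 2 ≤ W y)
    (hZ : Integrable fun x => exp (-W x)) (u : EuclideanSpace ℝ (Fin n))
    (h1 : Integrable (fun x => ⟪u, x⟫) (volume.tilted fun x => -W x))
    (h2 : Integrable (fun x => ⟪u, x⟫ ^ 2) (volume.tilted fun x => -W x)) :
    ∫ x, ⟪u, x⟫ ^ 2 ∂(volume.tilted fun x => -W x) - (∫ x, ⟪u, x⟫ ∂(volume.tilted fun x => -W x)) ^ 2 ≤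
      lam⁻¹ * ‖u‖ ^ 2 := by
  have := sq_moment_inner_le hlam hWc hW hZ u h1 h2
  linarith

/-- **BL AT `e^{−P}`**: `Var_ν(e^{−P}) ≤ λ⁻¹·∫‖∇e^{−P}‖² dν` for `P ∈ C¹` with the displayed integrabilities. [folklore] -/
theorem variance_exp_neg_le {W P : EuclideanSpace ℝ (Fin n) → ℝ} {lam : ℝ} (hlam : 0 < lam) (hWc : Continuous W)
    (hW : ∀ x y : EuclideanSpace ℝ (Fin n), W x + ⟪gradient W x, y - x⟫ + lam / 2 * ‖y - x‖ ^ 2 ≤ W y)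
    (hZ : Integrable fun x => exp (-W x)) (hP : ContDiff ℝ 1 P)
    (g1 : Integrable (fun x => exp (-P x)) (volume.tilted fun x => -W x))
    (g2 : Integrable (fun x => exp (-P x) ^ 2) (volume.tilted fun x => -W x))
    (g3 : Integrable (fun x => ‖fderiv ℝ (fun y => exp (-P y)) x‖ ^ 2) (volume.tilted fun x => -W x)) :
    ∫ x, exp (-P x) ^ 2 ∂(volume.tilted fun x => -W x) - (∫ x, exp (-P x) ∂(volume.tilted fun x => -W x)) ^ 2 ≤
      lam⁻¹ * ∫ x, ‖fderiv ℝ (fun y => exp (-P y)) x‖ ^ 2 ∂(volume.tilted fun x => -W x) :=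
  variance_tilted_le hlam hWc hW hZ (hP.neg.exp) g1 g2 g3

/-- **THE SHIFT OF THE TILTED MEAN BY A PERTURBATION, DERIVATIVE-FREE (T-60e as a theorem).**  `W` continuous, `λ`-uniformly convex
(first-order letter), `e^{−W}` integrable, `ν = volume.tilted (−W)`; `P ∈ C¹` with `e^{−P}`, `e^{−2P}`‐type and gradient integrabilities
under `ν` displayed, `u` with first ∕ second moments under `ν`; `a > 0` free.  Then, with `ν_P = ν.tilted (−P)` (= the tilt by
`−(W + P)`, `tilted_tilted`):
`|∫⟪u,x⟫dν_P − ∫⟪u,x⟫dν| ≤ λ⁻¹·((a∕2)‖u‖² + (∫‖∇e^{−P}‖² dν)∕(2a)) ∕ ∫e^{−P}dν`, and `∫e^{−P}dν ≥ e^{−∫P dν}`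
(`integral_exp_neg_ge_exp_neg_integral`). [folklore] -/
theorem abs_tiltedMean_shift_le {W P : EuclideanSpace ℝ (Fin n) → ℝ} {lam a : ℝ} (hlam : 0 < lam) (ha : 0 < a)
    (hWc : Continuous W)
    (hW : ∀ x y : EuclideanSpace ℝ (Fin n), W x + ⟪gradient W x, y - x⟫ + lam / 2 * ‖y - x‖ ^ 2 ≤ W y)
    (hZ : Integrable fun x => exp (-W x)) (hP : ContDiff ℝ 1 P) (u : EuclideanSpace ℝ (Fin n))
    (h1 : Integrable (fun x => ⟪u, x⟫) (volume.tilted fun x => -W x))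
    (h2 : Integrable (fun x => ⟪u, x⟫ ^ 2) (volume.tilted fun x => -W x))
    (g1 : Integrable (fun x => exp (-P x)) (volume.tilted fun x => -W x))
    (g2 : Integrable (fun x => exp (-P x) ^ 2) (volume.tilted fun x => -W x))
    (g3 : Integrable (fun x => ‖fderiv ℝ (fun y => exp (-P y)) x‖ ^ 2) (volume.tilted fun x => -W x))
    (hfg : Integrable (fun x => ⟪u, x⟫ * exp (-P x)) (volume.tilted fun x => -W x)) :
    |∫ x, ⟪u, x⟫ ∂((volume.tilted fun x => -W x).tilted fun x => -P x) - ∫ x, ⟪u, x⟫ ∂(volume.tilted fun x => -W x)| ≤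
      lam⁻¹ * (a / 2 * ‖u‖ ^ 2 + (∫ x, ‖fderiv ℝ (fun y => exp (-P y)) x‖ ^ 2 ∂(volume.tilted fun x => -W x)) / (2 * a)) /
        ∫ x, exp (-P x) ∂(volume.tilted fun x => -W x) := by
  haveI : IsProbabilityMeasure (volume.tilted fun x : EuclideanSpace ℝ (Fin n) => -W x) := isProbabilityMeasure_tilted hZ
  have hZP : 0 < ∫ x, exp (-P x) ∂(volume.tilted fun x => -W x) := integral_exp_pos g1
  rw [tiltedMean_sub_eq_cov_div _ g1, abs_div, abs_of_pos hZP]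
  refine div_le_div_of_nonneg_right ?_ hZP.le
  refine (abs_cov_le_amgm _ ha h1 g1 h2 g2 hfg).trans ?_
  have hv1 := variance_inner_le hlam hWc hW hZ u h1 h2
  have hv2 := variance_exp_neg_le hlam hWc hW hZ hP g1 g2 g3
  have hI : 0 ≤ ∫ x, ‖fderiv ℝ (fun y => exp (-P y)) x‖ ^ 2 ∂(volume.tilted fun x => -W x) :=
    integral_nonneg fun x => sq_nonneg _
  have e : lam⁻¹ * (a / 2 * ‖u‖ ^ 2 + (∫ x, ‖fderiv ℝ (fun y => exp (-P y)) x‖ ^ 2 ∂(volume.tilted fun x => -W x)) / (2 * a)) =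
      a / 2 * (lam⁻¹ * ‖u‖ ^ 2) +
        (lam⁻¹ * ∫ x, ‖fderiv ℝ (fun y => exp (-P y)) x‖ ^ 2 ∂(volume.tilted fun x => -W x)) / (2 * a) := by ring
  rw [e]
  gcongr

end Euclidean

end Summit.QuantumFields.BalabanUV.T4Continuum.NE7b.TiltedMeanShift

end
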